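import Mathlib.Data.Real.Basic
import Mathlib.Tactic.Linarith
import Mathlib.Tactic.Ring
import Mathlib.Tactic.Positivity
import HarnessLib
import HarnessLib.Audit

/-!
# `NoHeavyLowerTail` (crux stmt-CriticalPhenomena-4575), Sahi programme P4: the 2×2 exchange lemma — phantom monotonicity (the relative-saturation reduction)

Support file (cell `prim-l12`, seat P4, generation 22; `--supports stmt-CriticalPhenomena-4575`).  No named facts, no sorries;
standard axioms; def-free (pure real arithmetic).

Context (HOME prim-l12-p4/FROM-prim-l12-p4-gen22-SATURATION.md §0 F1).  In the exchange expression
`Φ_i = X_a + R(KK'V) + R(LL'V) − need(K,L') − need(L,K') + (1−v)·B_i` (`need(X,Y) = w(X)a(Y) + w(Y)a(X) − v·w(X)w(Y)`,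
`B₂ = Har(P,P') + (p−k)(p'−l') + (p−l)(p'−k')`, `B₁ = Har(P,P') + (p−k)(k'−o') + (p−o)(p'−k')`) the certificate `R` and the term
`X_a` see the configuration sets `K, L, K', L'` only through their traces on the slot `V`.  Replacing `K` by a larger up-set
`K₂` with the same trace (`K ⊆ K₂ ⊆ P`, `K₂∩V = K∩V`: more "phantom" mass `w(K₂) ≥ w(K)`, same `a(K)`) therefore changes only the
`R`-free part `−need(K,L') − need(L,K') + (1−v)·B_i`, which is AFFINE in `k = w(K)` with slope
`c(L') − (1−v)·p'` (type 2; `c(L') = w(L') − a(L')` the phantom mass of `L'`) resp. `−κ(L') − (1−v)(k'−o')` (type 1;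
`κ(L') = a(L') − v·w(L')`), both `≤ 0` for up-sets inside `P'` (Harris: `c(L') ≤ c(P') ≤ (1−v)w(P')`, `κ(L') ≥ 0`).  Hence the
exchange expression can only DECREASE when `K, L, K', L'` are replaced by their RELATIVE SATURATIONS `P∩sat(K)`, … (largest
up-sets inside `P`, `P'` with the same traces): it suffices to prove the exchange lemma for relatively saturated configurations
(numerically: 0 violations / 2·10⁷, lab/csrc; and after this reduction the Heyting-arrow packings of gen 21 are no longer needed,
memo F2–F3).  This file records the two monotonicity statements as inequalities between the `R`-free parts at the smaller
masses `(k,l,k',l')` and at the larger masses `(k₂,l₂,k₂',l₂')`, under the four slope hypotheses (stated for the sets met along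
the path `k → k₂`, `l → l₂`, `k' → k₂'`, `l' → l₂'`).
-/

namespace Summit.CriticalPhenomena.PercolationContinuityZ3.Theorems.SahiE3ExchangePhantom

/-- **Phantom monotonicity, bracket of type 2.**  Reals: slot mass `v`, masses `p, p'`, traces `aK, aL, aK', aL'`, smaller
masses `k ≤ k₂`, `l ≤ l₂`, `k' ≤ k₂'`, `l' ≤ l₂'`, and the four slope hypotheses `w(X) − a(X) ≤ (1−v)·w(P_side)` for
`X = L', K'` (original) and `X = K₂, L₂` (enlarged).  Then the `R`-free part of the type-2 exchange expression at the larger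
masses is at most its value at the smaller masses. [this work] -/
theorem phantom_antitone₂ (v p p' aK aL aK' aL' k l k' l' k₂ l₂ k₂' l₂' : ℝ)
    (hk : k ≤ k₂) (hl : l ≤ l₂) (hk' : k' ≤ k₂') (hl' : l' ≤ l₂')
    (hcL' : l' - aL' ≤ (1 - v) * p') (hcK' : k' - aK' ≤ (1 - v) * p')
    (hcK₂ : k₂ - aK ≤ (1 - v) * p) (hcL₂ : l₂ - aL ≤ (1 - v) * p) :
    -(k₂ * aL' + l₂' * aK - v * k₂ * l₂') - (l₂ * aK' + k₂' * aL - v * l₂ * k₂')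
        + (1 - v) * ((p - k₂) * (p' - l₂') + (p - l₂) * (p' - k₂'))
      ≤ -(k * aL' + l' * aK - v * k * l') - (l * aK' + k' * aL - v * l * k')
        + (1 - v) * ((p - k) * (p' - l') + (p - l) * (p' - k')) := by
  -- telescoping along k → k₂ (slope l' − aL' − (1−v)p'), l → l₂ (slope k' − aK' − (1−v)p'),
  -- k' → k₂' (slope l₂ − aL − (1−v)p), l' → l₂' (slope k₂ − aK − (1−v)p); each step is (Δmass)·(slope) ≤ 0.
  have s1 : 0 ≤ (k₂ - k) * ((1 - v) * p' - (l' - aL')) := mul_nonneg (by linarith) (by linarith)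
  have s2 : 0 ≤ (l₂ - l) * ((1 - v) * p' - (k' - aK')) := mul_nonneg (by linarith) (by linarith)
  have s3 : 0 ≤ (k₂' - k') * ((1 - v) * p - (l₂ - aL)) := mul_nonneg (by linarith) (by linarith)
  have s4 : 0 ≤ (l₂' - l') * ((1 - v) * p - (k₂ - aK)) := mul_nonneg (by linarith) (by linarith)
  nlinarith [s1, s2, s3, s4]

/-- **Phantom monotonicity, bracket of type 1** (`B₁ = Har(P,P') + (p−k)(k'−o') + (p−o)(p'−k')`): same masses, slope hypotheses
`κ(X) = a(X) − v·w(X) ≥ 0` for `X = L', K'` (original) and `X = K₂, L₂` (enlarged), `v ≤ 1`, and the nestings `o' ≤ k'`,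
`o ≤ k` (corner masses below the `K`-masses). [this work] -/
theorem phantom_antitone₁ (v p p' o o' aK aL aK' aL' k l k' l' k₂ l₂ k₂' l₂' : ℝ)
    (hv : v ≤ 1) (hk : k ≤ k₂) (hl : l ≤ l₂) (hk' : k' ≤ k₂') (hl' : l' ≤ l₂')
    (hκL' : v * l' ≤ aL') (hκK' : v * k' ≤ aK') (hκK₂ : v * k₂ ≤ aK) (hκL₂ : v * l₂ ≤ aL)
    (ho' : o' ≤ k') (ho : o ≤ k) :
    -(k₂ * aL' + l₂' * aK - v * k₂ * l₂') - (l₂ * aK' + k₂' * aL - v * l₂ * k₂')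
        + (1 - v) * ((p - k₂) * (k₂' - o') + (p - o) * (p' - k₂'))
      ≤ -(k * aL' + l' * aK - v * k * l') - (l * aK' + k' * aL - v * l * k')
        + (1 - v) * ((p - k) * (k' - o') + (p - o) * (p' - k')) := by
  -- slopes: ∂/∂k = −(aL' − v l') − (1−v)(k'−o') ≤ 0; ∂/∂l = −(aK' − v k') ≤ 0;
  -- ∂/∂k' = −(aL − v l₂) − (1−v)(k₂ − o) ≤ 0 (at the enlarged k₂, l₂); ∂/∂l' = −(aK − v k₂) ≤ 0.
  have s1 : 0 ≤ (k₂ - k) * ((aL' - v * l') + (1 - v) * (k' - o')) :=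
    mul_nonneg (by linarith) (add_nonneg (by linarith) (mul_nonneg (by linarith) (by linarith)))
  have s2 : 0 ≤ (l₂ - l) * (aK' - v * k') := mul_nonneg (by linarith) (by linarith)
  have s3 : 0 ≤ (k₂' - k') * ((aL - v * l₂) + (1 - v) * (k₂ - o)) :=
    mul_nonneg (by linarith) (add_nonneg (by linarith) (mul_nonneg (by linarith) (by linarith)))
  have s4 : 0 ≤ (l₂' - l') * (aK - v * k₂) := mul_nonneg (by linarith) (by linarith)
  nlinarith [s1, s2, s3, s4]

end Summit.CriticalPhenomena.PercolationContinuityZ3.Theorems.SahiE3ExchangePhantom
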